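import Mathlib.Analysis.Calculus.InverseFunctionTheorem.ContDiff
import Mathlib.Analysis.Calculus.ContDiff.Operations
import Mathlib.Analysis.Calculus.Deriv.Prod
import Mathlib.Analysis.Calculus.Deriv.Comp
import Mathlib.Topology.Algebra.Module.FiniteDimension
import Mathlib.LinearAlgebra.FiniteDimensional.Lemmas
import HarnessLib

/-!
# The period of a family of closed orbits is a smooth function of the first integrals

General dynamics / differential topology (topic `Geometry/Manifold`, sequel of
`FlowTimeReparametrisation.lean`), written for the Dehn–Nielsen–Baer seat
(`Literature/Topology/FourManifolds/DehnNielsenBaerSurface.lean`): a Dehn twist about a closed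
orbit of a flow `θ` with first integral `H` is the reparametrised flow map `x ↦ θ(μ(H x)·P(H x), x)`
(`Literature.Geometry.Manifold.flowReparamDiffeomorph`), where `P(s)` is THE PERIOD of the closed
orbit at level `s`; that `P` can be chosen smooth is the content of this file.  It is the classical
smoothness of the Poincaré first-return time (Hirsch–Smale / Lee, flows; Farb–Margalit (2012),
§3.1.1 uses the explicit period `2π` of the rotation flow of the annulus), obtained here from the
inverse function theorem in the following coordinate-free form.

**Setting.** `E` a real normed space, `F` a real Banach space; `θ : ℝ × E → E` a smooth global flow
(`θ(0, x) = x`, `θ(t, θ(s, x)) = θ(t + s, x)`); `H : E → F` invariant (`H(θ(t, x)) = H x`: the first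
integrals); `σ : F → E` a smooth **section of `H` through a periodic point**: `H(σ s) = s` for `s`
near `s₀` and `θ(T₀, σ s₀) = σ s₀`; and the non-degeneracy: the map `Λ(t, s) = θ(t, σ s)` has an
invertible differential at `(T₀, s₀)` (for `E` of dimension `2`, `F = ℝ`, this says exactly that the
field `X = ∂ₜθ(0, ·)` does not vanish at `σ s₀`, since `dH(X) = 0 ≠ dH(∂ₛΛ)`).

* `exists_contDiffAt_period` — **there is a smooth germ `P` at `s₀` with `P s₀ = T₀` and
  `θ(P s, σ s) = σ s` for all `s` near `s₀`**: the local inverse `Λ⁻¹` near `σ s₀ = Λ(T₀, s₀)`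
  (Mathlib's `ContDiffAt.localInverse`) sends `σ s` to a pair `(P s, S s)` with
  `θ(P s, σ (S s)) = σ s`; applying `H` gives `S s = s`.
* `apply_period_of_mem_flowSaturation` — consequently `θ(P(H x), x) = x` for every point `x = θ(u, σ s)`
  of the orbits through the good section points (group law), i.e. **`P ∘ H` is an invariant time
  function whose value at each point of the saturated family is a period of that point** — the
  hypothesis `flowReparam_of_period` of the twist construction.
* `H_apply_of_mem_flowSaturation`, `flowSaturation_invariant` — bookkeeping on the saturated set
  `flowSaturation θ σ S = {θ(u, σ s) | u ∈ ℝ, s ∈ S}`;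
* `exists_contDiffAt_period_of_finrank_eq_two` — **planar form**: for `dim E = 2` and one smooth
  first integral `H : E → ℝ`, the non-degeneracy holds as soon as the velocity of the periodic orbit
  is non-zero (`dH(v) = 0`, `dH(∂ₛΛ) = 1` make the two columns independent), so the smooth period
  germ exists under that hypothesis alone; `exists_nhds_period_flowSaturation` — local assembly.

Everything is proved; no definitions besides the saturated set, no named facts (D-0026).  Not here
(sequel): openness/closedness of the saturated family inside `H⁻¹(J)` (compactness of the closed
orbits), which makes the cut-off time function `(μ·P) ∘ H` globally smooth.

## References

* B. Farb, D. Margalit, *A primer on mapping class groups*, PMS 49 (2012), §3.1.1 (PDF p. 62: the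
  twist map as the time-`2πt` map of the rotation flow). [FarbMargalit2012]
* J. M. Lee, *Introduction to Smooth Manifolds*, 2nd ed., GTM 218 (2012), Thm. 9.12 (smooth global
  flows), Thm. C.34 (inverse function theorem). [LeeSmoothManifolds2013]
-/

open scoped ContDiff Topology
open Set Function Filter

noncomputable section

namespace Literature.Geometry.Manifold

section Period

variable {E : Type*} [NormedAddCommGroup E] [NormedSpace ℝ E]
  {F : Type*} [NormedAddCommGroup F] [NormedSpace ℝ F] [CompleteSpace F]

/-- **Smooth period function along a section** (the first-return time to a section parametrised by
the first integrals is smooth, and is a genuine period).  See the file header for the setting.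
[cite: LeeSmoothManifolds2013, Thm. 9.12 and Thm. C.34] [cite: FarbMargalit2012, §3.1.1] -/
theorem exists_contDiffAt_period {θ : ℝ × E → E} (hθ : ContDiff ℝ ∞ θ)
    {H : E → F} (hH : ∀ t x, H (θ (t, x)) = H x)
    {σ : F → E} (hσ : ContDiff ℝ ∞ σ) {s₀ : F} (hHσ : ∀ᶠ s in 𝓝 s₀, H (σ s) = s)
    {T₀ : ℝ} (hT : θ (T₀, σ s₀) = σ s₀)
    {L : (ℝ × F) ≃L[ℝ] E}
    (hΛ : HasFDerivAt (fun p : ℝ × F => θ (p.1, σ p.2)) (L : ℝ × F →L[ℝ] E) (T₀, s₀)) :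
    ∃ P : F → ℝ, ContDiffAt ℝ ∞ P s₀ ∧ P s₀ = T₀ ∧ ∀ᶠ s in 𝓝 s₀, θ (P s, σ s) = σ s := by
  set Λ : ℝ × F → E := fun p => θ (p.1, σ p.2) with hΛdef
  have hΛc : ContDiff ℝ ∞ Λ := hθ.comp (contDiff_fst.prodMk (hσ.comp contDiff_snd))
  have hΛat : ContDiffAt ℝ ∞ Λ (T₀, s₀) := hΛc.contDiffAt
  have hn : (∞ : WithTop ℕ∞) ≠ 0 := by simp
  have hpt : Λ (T₀, s₀) = σ s₀ := hT
  -- the local inverse of `Λ` near `σ s₀`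
  set g : E → ℝ × F := hΛat.localInverse hΛ hn with hgdef
  have hg_apply : g (σ s₀) = (T₀, s₀) := by rw [← hpt]; exact hΛat.localInverse_apply_image hΛ hn
  have hg_smooth : ContDiffAt ℝ ∞ g (σ s₀) := by rw [← hpt]; exact hΛat.to_localInverse hΛ hn
  have hg_cont : ContinuousAt g (σ s₀) := hg_smooth.continuousAt
  have hright : ∀ᶠ y in 𝓝 (σ s₀), Λ (g y) = y := by
    have h := (hΛat.hasStrictFDerivAt' hΛ hn).eventually_right_inverse
    rw [hpt] at h
    exact h
  -- the section is continuous, so everything can be pulled back along `σ`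
  have hσt : Tendsto σ (𝓝 s₀) (𝓝 (σ s₀)) := hσ.continuous.continuousAt
  have h1 : ∀ᶠ s in 𝓝 s₀, Λ (g (σ s)) = σ s := hσt.eventually hright
  have hgt : Tendsto (fun s => (g (σ s)).2) (𝓝 s₀) (𝓝 s₀) := by
    have hc : ContinuousAt (fun s => (g (σ s)).2) s₀ :=
      continuous_snd.continuousAt.comp (hg_cont.comp hσ.continuous.continuousAt)
    simpa [hg_apply] using hc.tendsto
  have h3 : ∀ᶠ s in 𝓝 s₀, H (σ (g (σ s)).2) = (g (σ s)).2 := hgt.eventually hHσ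
  refine ⟨fun s => (g (σ s)).1, ?_, ?_, ?_⟩
  · exact contDiffAt_fst.comp s₀ (hg_smooth.comp s₀ hσ.contDiffAt)
  · simp [hg_apply]
  · filter_upwards [h1, hHσ, h3] with s e1 e2 e3
    -- `e1 : θ ((g (σ s)).1, σ (g (σ s)).2) = σ s`; apply `H` to identify the second component
    have hS : (g (σ s)).2 = s := by
      have h := congrArg H e1
      change H (θ ((g (σ s)).1, σ (g (σ s)).2)) = H (σ s) at h
      rw [hH, e3, e2] at h
      exact h
    have e1' : θ ((g (σ s)).1, σ (g (σ s)).2) = σ s := e1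
    rw [hS] at e1'
    exact e1'

end Period

section Saturation

variable {E : Type*} {F : Type*}

/-- **The flowSaturation** of a set `S` of section parameters: all points `θ(u, σ s)`, `u ∈ ℝ`, `s ∈ S`,
of the orbits through the section points `σ s`. [folklore] -/
def flowSaturation (θ : ℝ × E → E) (σ : F → E) (S : Set F) : Set E :=
  (fun p : ℝ × F => θ (p.1, σ p.2)) '' (univ ×ˢ S)

/-- Membership in the flowSaturation. [folklore] -/
theorem mem_flowSaturation_iff {θ : ℝ × E → E} {σ : F → E} {S : Set F} {x : E} :
    x ∈ flowSaturation θ σ S ↔ ∃ u s, s ∈ S ∧ θ (u, σ s) = x := by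
  constructor
  · rintro ⟨⟨u, s⟩, ⟨-, hs⟩, rfl⟩; exact ⟨u, s, hs, rfl⟩
  · rintro ⟨u, s, hs, rfl⟩; exact ⟨(u, s), ⟨mem_univ _, hs⟩, rfl⟩

/-- Section points lie in the flowSaturation. [folklore] -/
theorem apply_mem_flowSaturation {θ : ℝ × E → E} (h0 : ∀ x, θ (0, x) = x) (σ : F → E) {S : Set F}
    {s : F} (hs : s ∈ S) : σ s ∈ flowSaturation θ σ S :=
  mem_flowSaturation_iff.2 ⟨0, s, hs, h0 _⟩

/-- **The flowSaturation is invariant under the flow.** [folklore] -/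
theorem flowSaturation_invariant {θ : ℝ × E → E} (hadd : ∀ t s x, θ (t, θ (s, x)) = θ (t + s, x))
    (σ : F → E) (S : Set F) (t : ℝ) {x : E} (hx : x ∈ flowSaturation θ σ S) :
    θ (t, x) ∈ flowSaturation θ σ S := by
  obtain ⟨u, s, hs, rfl⟩ := mem_flowSaturation_iff.1 hx
  exact mem_flowSaturation_iff.2 ⟨t + u, s, hs, by rw [hadd]⟩

/-- **On the flowSaturation of the good parameters the first integrals read off the parameter**:
`H(θ(u, σ s)) = s`. [folklore] -/
theorem H_apply_of_mem_flowSaturation {θ : ℝ × E → E} {H : E → F} (hH : ∀ t x, H (θ (t, x)) = H x)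
    {σ : F → E} {S : Set F} (hHσ : ∀ s ∈ S, H (σ s) = s) {x : E} (hx : x ∈ flowSaturation θ σ S)
    {u : ℝ} {s : F} (hs : s ∈ S) (hxs : θ (u, σ s) = x) : H x = s := by
  subst hxs
  rw [hH, hHσ s hs]

/-- **`P ∘ H` is a period at every point of the saturated family**: if `θ(P s, σ s) = σ s` and
`H(σ s) = s` for all `s ∈ S`, then `θ(P(H x), x) = x` for every `x` on an orbit through some `σ s`,
`s ∈ S` (group law).  This is the hypothesis `flowReparam_of_period` of the twist construction of
`FlowTimeReparametrisation.lean`, on the whole family at once. [cite: FarbMargalit2012, §3.1.1] -/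
theorem apply_period_of_mem_flowSaturation {θ : ℝ × E → E}
    (hadd : ∀ t s x, θ (t, θ (s, x)) = θ (t + s, x))
    {H : E → F} (hH : ∀ t x, H (θ (t, x)) = H x) {σ : F → E} {S : Set F} {P : F → ℝ}
    (hHσ : ∀ s ∈ S, H (σ s) = s) (hP : ∀ s ∈ S, θ (P s, σ s) = σ s)
    {x : E} (hx : x ∈ flowSaturation θ σ S) : θ (P (H x), x) = x := by
  obtain ⟨u, s, hs, rfl⟩ := mem_flowSaturation_iff.1 hx
  rw [hH, hHσ s hs, hadd, add_comm, ← hadd, hP s hs]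

/-- The invariant time function `(μ · P) ∘ H` of a twist is constant along the orbits (any function
of the first integrals is). [folklore] -/
theorem timeFunction_invariant {θ : ℝ × E → E} {H : E → F} (hH : ∀ t x, H (θ (t, x)) = H x)
    (μ P : F → ℝ) (t : ℝ) (x : E) :
    (fun y => μ (H y) * P (H y)) (θ (t, x)) = (fun y => μ (H y) * P (H y)) x := by
  simp only [hH]

/-- **Where the bump is `1` the twist time is a full period**: on the saturated family, at points
with `μ(H x) = 1`, `θ(μ(H x)·P(H x), x) = x`. [cite: FarbMargalit2012, §3.1.1] -/
theorem apply_timeFunction_of_eq_one {θ : ℝ × E → E}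
    (hadd : ∀ t s x, θ (t, θ (s, x)) = θ (t + s, x))
    {H : E → F} (hH : ∀ t x, H (θ (t, x)) = H x) {σ : F → E} {S : Set F} {P : F → ℝ}
    (hHσ : ∀ s ∈ S, H (σ s) = s) (hP : ∀ s ∈ S, θ (P s, σ s) = σ s) (μ : F → ℝ)
    {x : E} (hx : x ∈ flowSaturation θ σ S) (hμ : μ (H x) = 1) :
    θ (μ (H x) * P (H x), x) = x := by
  rw [hμ, one_mul]
  exact apply_period_of_mem_flowSaturation hadd hH hHσ hP hx

end Saturation

section Assembly

variable {E : Type*} [NormedAddCommGroup E] [NormedSpace ℝ E]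
  {F : Type*} [NormedAddCommGroup F] [NormedSpace ℝ F] [CompleteSpace F]

/-- **Local assembly**: near a non-degenerate periodic section point there are a neighbourhood `S`
of `s₀` and a function `P`, smooth at `s₀` with `P s₀ = T₀`, such that `θ(P(H x), x) = x` on the
whole flowSaturation of `S`. [cite: LeeSmoothManifolds2013, Thm. 9.12 and Thm. C.34] -/
theorem exists_nhds_period_flowSaturation {θ : ℝ × E → E} (hθ : ContDiff ℝ ∞ θ)
    (hadd : ∀ t s x, θ (t, θ (s, x)) = θ (t + s, x))
    {H : E → F} (hH : ∀ t x, H (θ (t, x)) = H x)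
    {σ : F → E} (hσ : ContDiff ℝ ∞ σ) {s₀ : F} (hHσ : ∀ᶠ s in 𝓝 s₀, H (σ s) = s)
    {T₀ : ℝ} (hT : θ (T₀, σ s₀) = σ s₀)
    {L : (ℝ × F) ≃L[ℝ] E}
    (hΛ : HasFDerivAt (fun p : ℝ × F => θ (p.1, σ p.2)) (L : ℝ × F →L[ℝ] E) (T₀, s₀)) :
    ∃ P : F → ℝ, ContDiffAt ℝ ∞ P s₀ ∧ P s₀ = T₀ ∧ ∃ S ∈ 𝓝 s₀,
      (∀ s ∈ S, H (σ s) = s) ∧ (∀ s ∈ S, θ (P s, σ s) = σ s) ∧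
      ∀ x ∈ flowSaturation θ σ S, θ (P (H x), x) = x := by
  obtain ⟨P, hPs, hP0, hP⟩ := exists_contDiffAt_period hθ hH hσ hHσ hT hΛ
  refine ⟨P, hPs, hP0, {s | H (σ s) = s ∧ θ (P s, σ s) = σ s}, ?_, fun s hs => hs.1, fun s hs => hs.2,
    fun x hx => apply_period_of_mem_flowSaturation hadd hH (fun s hs => hs.1) (fun s hs => hs.2) hx⟩
  exact hHσ.and hP


/-- **Planar form of the non-degeneracy.**  If `E` has dimension `2` and `F = ℝ` (one first
integral `H`, smooth), the differential of `Λ(t, s) = θ(t, σ s)` at `(T₀, s₀)` is invertible as soon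
as the velocity `v = ∂ₜθ(T₀, σ s₀)` of the periodic orbit is non-zero: its columns `v` and
`w = ∂ₛΛ` satisfy `dH(v) = 0` (invariance) and `dH(w) = 1` (`H ∘ σ = id`).  Hence the smooth period
germ exists under that hypothesis alone. [cite: LeeSmoothManifolds2013, Thm. 9.12 and Thm. C.34] -/
theorem exists_contDiffAt_period_of_finrank_eq_two [FiniteDimensional ℝ E]
    (hE : Module.finrank ℝ E = 2)
    {θ : ℝ × E → E} (hθ : ContDiff ℝ ∞ θ) {H : E → ℝ} (hHs : ContDiff ℝ ∞ H)
    (hH : ∀ t x, H (θ (t, x)) = H x)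
    {σ : ℝ → E} (hσ : ContDiff ℝ ∞ σ) {s₀ : ℝ} (hHσ : ∀ᶠ s in 𝓝 s₀, H (σ s) = s)
    {T₀ : ℝ} (hT : θ (T₀, σ s₀) = σ s₀)
    {v : E} (hv : HasDerivAt (fun t => θ (t, σ s₀)) v T₀) (hv0 : v ≠ 0) :
    ∃ P : ℝ → ℝ, ContDiffAt ℝ ∞ P s₀ ∧ P s₀ = T₀ ∧ ∀ᶠ s in 𝓝 s₀, θ (P s, σ s) = σ s := by
  set Λ : ℝ × ℝ → E := fun p => θ (p.1, σ p.2) with hΛdef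
  have hΛc : ContDiff ℝ ∞ Λ := hθ.comp (contDiff_fst.prodMk (hσ.comp contDiff_snd))
  have hΛd : HasFDerivAt Λ (fderiv ℝ Λ (T₀, s₀)) (T₀, s₀) :=
    ((hΛc.differentiable (by simp)) _).hasFDerivAt
  set L₀ : ℝ × ℝ →L[ℝ] E := fderiv ℝ Λ (T₀, s₀) with hL₀
  have hHd : ∀ y, HasFDerivAt H (fderiv ℝ H y) y := fun y => ((hHs.differentiable (by simp)) y).hasFDerivAt
  -- first column: the velocity `v`
  have hcol1 : L₀ (1, 0) = v := by
    have hi : HasDerivAt (fun t : ℝ => ((t, s₀) : ℝ × ℝ)) ((1, 0) : ℝ × ℝ) T₀ :=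
      (hasDerivAt_id T₀).prodMk (hasDerivAt_const T₀ s₀)
    have hc : HasDerivAt (Λ ∘ fun t : ℝ => ((t, s₀) : ℝ × ℝ)) (L₀ (1, 0)) T₀ := hΛd.comp_hasDerivAt T₀ hi
    have hfun : (Λ ∘ fun t : ℝ => ((t, s₀) : ℝ × ℝ)) = fun t => θ (t, σ s₀) := rfl
    rw [hfun] at hc
    exact hc.unique hv
  -- `dH(v) = 0`
  have hdHv : fderiv ℝ H (σ s₀) v = 0 := by
    have hc : HasDerivAt (fun t : ℝ => H (θ (t, σ s₀))) (fderiv ℝ H (σ s₀) v) T₀ := by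
      have h := (hHd (θ (T₀, σ s₀))).comp_hasDerivAt T₀ hv
      rw [hT] at h
      exact h
    have hconst : (fun t : ℝ => H (θ (t, σ s₀))) = fun _ => H (σ s₀) := funext fun t => hH t _
    rw [hconst] at hc
    exact hc.unique (hasDerivAt_const T₀ _)
  -- second column `w` has `dH(w) = 1`
  have hdHw : fderiv ℝ H (σ s₀) (L₀ (0, 1)) = 1 := by
    have hi : HasDerivAt (fun s : ℝ => ((T₀, s) : ℝ × ℝ)) ((0, 1) : ℝ × ℝ) s₀ :=
      (hasDerivAt_const s₀ T₀).prodMk (hasDerivAt_id s₀)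
    have hc : HasDerivAt (Λ ∘ fun s : ℝ => ((T₀, s) : ℝ × ℝ)) (L₀ (0, 1)) s₀ := hΛd.comp_hasDerivAt s₀ hi
    have hc' : HasDerivAt (fun s : ℝ => H (Λ (T₀, s))) (fderiv ℝ H (σ s₀) (L₀ (0, 1))) s₀ := by
      have h : HasDerivAt (H ∘ (Λ ∘ fun s : ℝ => ((T₀, s) : ℝ × ℝ)))
          (fderiv ℝ H ((Λ ∘ fun s : ℝ => ((T₀, s) : ℝ × ℝ)) s₀) (L₀ (0, 1))) s₀ :=
        (hHd _).comp_hasDerivAt s₀ hc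
      have hpt : (Λ ∘ fun s : ℝ => ((T₀, s) : ℝ × ℝ)) s₀ = σ s₀ := hT
      rw [hpt] at h
      exact h
    have heq : (fun s : ℝ => H (Λ (T₀, s))) =ᶠ[𝓝 s₀] fun s => s := by
      filter_upwards [hHσ] with s hs
      change H (θ (T₀, σ s)) = s
      rw [hH, hs]
    exact (hc'.congr_of_eventuallyEq heq.symm).unique (hasDerivAt_id s₀)
  -- `L₀` is injective, hence an isomorphism `ℝ² ≅ E`
  have hinj : Injective (L₀ : ℝ × ℝ →ₗ[ℝ] E) := by
    intro p q hpq
    have hlin : ∀ r : ℝ × ℝ, L₀ r = r.1 • v + r.2 • L₀ (0, 1) := by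
      intro r
      have hr : r = r.1 • ((1, 0) : ℝ × ℝ) + r.2 • ((0, 1) : ℝ × ℝ) := by ext <;> simp
      conv_lhs => rw [hr]
      rw [map_add, map_smul, map_smul, hcol1]
    have h : L₀ (p - q) = 0 := by rw [map_sub]; exact sub_eq_zero.2 hpq
    rw [hlin] at h
    have h2 : (p - q).2 = 0 := by
      have := congrArg (fderiv ℝ H (σ s₀)) h
      rw [map_add, map_smul, map_smul, hdHv, hdHw, map_zero, smul_zero, zero_add, smul_eq_mul, mul_one] at this
      exact this
    have h1 : (p - q).1 = 0 := by
      rw [h2, zero_smul, add_zero] at h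
      exact (smul_eq_zero.1 h).resolve_right hv0
    exact Prod.ext (sub_eq_zero.1 h1) (sub_eq_zero.1 h2)
  have hdim : Module.finrank ℝ (ℝ × ℝ) = Module.finrank ℝ E := by simp [hE]
  set L : (ℝ × ℝ) ≃L[ℝ] E :=
    (LinearMap.linearEquivOfInjective (L₀ : ℝ × ℝ →ₗ[ℝ] E) hinj hdim).toContinuousLinearEquiv with hLdef
  have hLeq : (L : ℝ × ℝ →L[ℝ] E) = L₀ := ContinuousLinearMap.ext fun r => rfl
  exact exists_contDiffAt_period hθ hH hσ hHσ hT (hΛd.congr_fderiv hLeq.symm)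

end Assembly

end Literature.Geometry.Manifold

end
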